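import Literature.Analysis.SpecialFunctions.BesselKHalfIntegral
import HarnessLib

/-!
# Crux `UnitSpeedTwoPoint` — stub B1 `stub_besselKHalfLaplace` (line `yukawa_subordination`)

Crux stmt-CriticalPhenomena-17167 (`Theses.UnitLightCone.UnitSpeedTwoPoint`), line
`yukawa_subordination`, registered helper stub B1 feeding stub B (`stub_sommerfeldWeyl`):
**the `K_{1/2}` Laplace-type integral** (Gaussian subordination of `e^{-Ω|t|}/Ω`)

  `∫₀^∞ u^{-1/2} e^{-(β/u + αu)} du = √(π/α) e^{-2√(αβ)}`   (`α, β > 0`),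

with integrability of the integrand on `(0, ∞)`. This is the case `ν = ½` of
`∫₀^∞ u^{ν-1} e^{-β/u-αu} du = 2(β/α)^{ν/2} K_ν(2√(αβ))` (Watson, *Treatise*, §6.22 (15)) combined
with `K_{1/2}(z) = √(π/(2z)) e^{-z}` (ibid. §3.71 (13)); the lead applies it with `α = Ω²`,
`β = t²/4`.

RUNNING LOG (worker): everything below is proved; nothing is left open.

Proof. The tree file `Literature/Analysis/SpecialFunctions/BesselKHalfIntegral.lean` provides, at
unit scale `κ > 0`, the value `∫₀^∞ (√t)⁻¹ e^{-κ(t + 1/t)} dt = √(π/κ) e^{-2κ}`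
(`integral_inv_sqrt_mul_exp_eq`) together with integrability of the sum of the two halves
`((√t)⁻¹ + (√t)⁻¹ t⁻¹) e^{-κ(t+1/t)}` and of the `t^{-3/2}` half; integrability of the `t^{-1/2}`
half is their difference. The scaling `u = l t`, `l = √(β/α)`, `κ = √(αβ)` (`α l = κ = β / l`,
`BesselK0.mul_sqrt_div_eq`) turns the integrand `G(u) = (√u)⁻¹ e^{-(β/u + αu)}` into
`G(l t) = (√l)⁻¹ (√t)⁻¹ e^{-κ(t + 1/t)}`, so Mathlib's `integrableOn_Ioi_comp_mul_left_iff` and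
`integral_comp_mul_left_Ioi` give integrability and `∫ G = l (√l)⁻¹ √(π/κ) e^{-2κ}`; finally
`l (√l)⁻¹ = √l` and `√l √(π/κ) = √(π/α)` because `l/κ = 1/α`.

References: G. N. Watson, *A Treatise on the Theory of Bessel Functions*, 2nd ed. (1944),
§3.71 (13), §6.22 (15). All steps are standard analysis [folklore].
-/

noncomputable section

open MeasureTheory Set Filter Real
open Literature.Analysis.SpecialFunctions.BesselKHalf Literature.Analysis.SpecialFunctions.BesselK0

namespace Summit.CriticalPhenomena.Ising3DConformalLimit.Cruxes.UnitSpeedTwoPoint.YukawaSubordination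

/-- Integrability of the `t^{-1/2}` half at unit scale: for `κ > 0`,
`t ↦ (√t)⁻¹ e^{-κ(t + 1/t)}` is integrable on `(0, ∞)` (the integrable sum of the two halves minus
the integrable `t^{-3/2}` half). [folklore] -/
theorem besselKHalfLaplace_integrableOn_inv_sqrt_mul_exp {κ : ℝ} (hκ : 0 < κ) :
    IntegrableOn (fun t : ℝ => (Real.sqrt t)⁻¹ * Real.exp (-κ * (t + t⁻¹))) (Ioi 0) := by
  have h : IntegrableOn (fun t : ℝ =>
      ((Real.sqrt t)⁻¹ + (Real.sqrt t)⁻¹ * t⁻¹) * Real.exp (-κ * (t + t⁻¹)) -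
        (Real.sqrt t)⁻¹ * t⁻¹ * Real.exp (-κ * (t + t⁻¹))) (Ioi 0) :=
    (integrableOn_and_integral_inv_sqrt_add_eq hκ).1.sub (integral_inv_sqrt_mul_inv_mul_exp_eq hκ).1
  refine h.congr_fun (fun t _ => ?_) measurableSet_Ioi
  ring

/-- Constant bookkeeping of the scaling `u = √(β/α) t`: with `l = √(β/α)` and `α l = κ`,
`l (√l)⁻¹ √(π/κ) = √(π/α)` (as `l (√l)⁻¹ = √l` and `l/κ = 1/α`). [folklore] -/
theorem besselKHalfLaplace_const {α l κ : ℝ} (hα : 0 < α) (hl : 0 < l) (hAl : α * l = κ) :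
    l * ((Real.sqrt l)⁻¹ * Real.sqrt (Real.pi / κ)) = Real.sqrt (Real.pi / α) := by
  have hsl : 0 < Real.sqrt l := Real.sqrt_pos.2 hl
  have e1 : l * (Real.sqrt l)⁻¹ = Real.sqrt l := by
    rw [mul_inv_eq_iff_eq_mul₀ hsl.ne', Real.mul_self_sqrt hl.le]
  rw [← mul_assoc, e1, ← Real.sqrt_mul hl.le (Real.pi / κ)]
  congr 1
  rw [← hAl]
  have hl' : l ≠ 0 := hl.ne'
  have hα' : α ≠ 0 := hα.ne'
  field_simp

/-- **Stub B1 (`K_{1/2}` Laplace integral).** For `α, β > 0` the function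
`u ↦ (√u)⁻¹ e^{-(β/u + αu)}` is integrable on `(0, ∞)` and
`∫₀^∞ (√u)⁻¹ e^{-(β/u + αu)} du = √(π/α) e^{-2√(αβ)}`, i.e. the case `ν = ½` of
`∫₀^∞ u^{ν-1} e^{-β/u-αu} du = 2(β/α)^{ν/2} K_ν(2√(αβ))` with `K_{1/2}(z) = √(π/(2z)) e^{-z}`;
by the scaling `u = √(β/α) t` from the unit-scale value in the tree.
[cite: Watson1944, §6.22 (15) and §3.71 (13)] -/
theorem stub_besselKHalfLaplace :
    ∀ α β : ℝ, 0 < α → 0 < β →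
      MeasureTheory.IntegrableOn
          (fun u : ℝ => (Real.sqrt u)⁻¹ * Real.exp (-(β * u⁻¹ + α * u))) (Set.Ioi 0) ∧
        ∫ u in Set.Ioi (0 : ℝ), (Real.sqrt u)⁻¹ * Real.exp (-(β * u⁻¹ + α * u)) =
          Real.sqrt (Real.pi / α) * Real.exp (-(2 * Real.sqrt (α * β))) := by
  intro α β hα hβ
  obtain ⟨hAl, hBl⟩ := mul_sqrt_div_eq hα hβ
  set κ : ℝ := Real.sqrt (α * β)
  have hκ : 0 < κ := Real.sqrt_pos.2 (mul_pos hα hβ)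
  set l : ℝ := Real.sqrt (β / α)
  have hl0 : 0 < l := Real.sqrt_pos.2 (div_pos hβ hα)
  set G : ℝ → ℝ := fun u => (Real.sqrt u)⁻¹ * Real.exp (-(β * u⁻¹ + α * u)) with hG
  -- `G(l t) = (√l)⁻¹ · (√t)⁻¹ e^{−κ(t + 1/t)}` (both sides vanish for `t ≤ 0`)
  have hcomp : ∀ t : ℝ, G (l * t) =
      (Real.sqrt l)⁻¹ * ((Real.sqrt t)⁻¹ * Real.exp (-κ * (t + t⁻¹))) := fun t => by
    simp only [hG]
    rcases le_or_gt t 0 with ht | ht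
    · have h1 : Real.sqrt (l * t) = 0 :=
        Real.sqrt_eq_zero'.2 (mul_nonpos_of_nonneg_of_nonpos hl0.le ht)
      have h2 : Real.sqrt t = 0 := Real.sqrt_eq_zero'.2 ht
      simp [h1, h2]
    have e : Real.exp (-(β * (l * t)⁻¹ + α * (l * t))) = Real.exp (-κ * (t + t⁻¹)) := by
      congr 1
      rw [mul_inv, show β * (l⁻¹ * t⁻¹) = (β / l) * t⁻¹ by ring, hBl,
        show α * (l * t) = (α * l) * t by ring, hAl]
      ring
    rw [e, Real.sqrt_mul hl0.le, mul_inv]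
    ring
  have hKint : IntegrableOn (fun t : ℝ => (Real.sqrt t)⁻¹ * Real.exp (-κ * (t + t⁻¹))) (Ioi 0) :=
    besselKHalfLaplace_integrableOn_inv_sqrt_mul_exp hκ
  have hint : IntegrableOn G (Ioi 0) := by
    have h1 : IntegrableOn (fun t => G (l * t)) (Ioi 0) := by
      simp_rw [hcomp]
      exact hKint.const_mul _
    have h2 := (integrableOn_Ioi_comp_mul_left_iff G 0 hl0).1 h1
    rwa [mul_zero] at h2
  refine ⟨hint, ?_⟩
  have h3 := integral_comp_mul_left_Ioi G 0 hl0
  rw [mul_zero] at h3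
  simp_rw [hcomp] at h3
  rw [integral_const_mul, smul_eq_mul, integral_inv_sqrt_mul_exp_eq hκ] at h3
  -- solve for `∫ G`
  have h4 : ∫ x in Ioi (0 : ℝ), G x =
      l * ((Real.sqrt l)⁻¹ * (Real.sqrt (Real.pi / κ) * Real.exp (-(2 * κ)))) := by
    rw [h3, ← mul_assoc, mul_inv_cancel₀ hl0.ne', one_mul]
  rw [h4]
  -- `l (√l)⁻¹ √(π/κ) = √(π/α)`
  calc l * ((Real.sqrt l)⁻¹ * (Real.sqrt (Real.pi / κ) * Real.exp (-(2 * κ))))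
      = l * ((Real.sqrt l)⁻¹ * Real.sqrt (Real.pi / κ)) * Real.exp (-(2 * κ)) := by ring
    _ = Real.sqrt (Real.pi / α) * Real.exp (-(2 * κ)) := by
      rw [besselKHalfLaplace_const hα hl0 hAl]

end Summit.CriticalPhenomena.Ising3DConformalLimit.Cruxes.UnitSpeedTwoPoint.YukawaSubordination

end
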